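import Mathlib
import Literature.NumberTheory.LFunctions.Zhang2022.Section15U009Assembly
import Literature.NumberTheory.LFunctions.Zhang2022.TypedSection15ASubsteps
import HarnessLib

/-!
# Zhang (2022) §15 u009 (p. 80, tex L4037) — the two typed halves `Step15_u009a`, `Step15_u009b` HOLD

Topic `Literature/NumberTheory/LFunctions/Zhang2022` (Landau–Siegel audit tree; verdict-neutral).
Y. Zhang, *Discrete mean estimates and the Landau–Siegel zero*, arXiv:2211.02515v1 (2022)
[Zhang2022LandauSiegel] — **an unrefereed manuscript under adjudication; nothing here asserts or
denies its Theorems 1–2.** ZHANG-L discharge lane (WP15, leaf `Typed.Section15A.Eq15_6`); THEOREM-ONLY.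

The typer's sub-step file `TypedSection15ASubsteps` splits `Z22:§15.u009` ("the sum over `ψ ∈ Ψ₁` can
be extended to the sum over `ψ ∈ Ψ`, and then the segment `𝔍(−1)` can be replaced by the line
`σ = −1/2`") into `Step15_u009a c′` (extension) and `Step15_u009b c′` (segment → line), stated with the
plumbing abbreviations `termSegU009`, `termLineU009`. Both are the statements proved — with the
abbreviations unfolded — as `U009.u009_extend_eventually` (`Section15U009Assembly`) and
`U009.u009_line_eventually` (`Section15U009Line`); this file records them BY NAME. (The whole node,
`Typed.Section15A.Step15_u009`, is `Typed.Section15A.step15_u009_holds`.)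

## References

* Y. Zhang, arXiv:2211.02515v1 (2022), §15 p. 80, tex L4037. [cite: Zhang2022LandauSiegel, §15 p. 80]
-/

noncomputable section

namespace Literature.NumberTheory.LFunctions.Zhang2022.Typed.Section15A

/-- **`Z22:§15.u009`, first half, DISCHARGED** (`Step15_u009a c′`: `τ(χ)Σ_{ψ∈Ψ₁}[…𝔍(−1)…] =
τ(χ)Σ_{ψ∈Ψ}[…𝔍(−1)…] + o(𝔓)` under (A)) — `U009.u009_extend_eventually`.
[cite: Zhang2022LandauSiegel, §15 p. 80, tex L4037] -/
theorem step15_u009a_holds (c' : ℝ) : Step15_u009a c' := U009.u009_extend_eventually c'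

/-- **`Z22:§15.u009`, second half, DISCHARGED** (`Step15_u009b c′`: `τ(χ)Σ_{ψ∈Ψ}[…𝔍(−1)…] =
τ(χ)Σ_{ψ∈Ψ}[…σ = −1/2…] + o(𝔓)`) — `U009.u009_line_eventually`.
[cite: Zhang2022LandauSiegel, §15 p. 80, tex L4037] -/
theorem step15_u009b_holds (c' : ℝ) : Step15_u009b c' := U009.u009_line_eventually c'

end Literature.NumberTheory.LFunctions.Zhang2022.Typed.Section15A
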